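import Literature.NumberTheory.EllipticCurves.WeierstrassSigmaDivision
import HarnessLib

/-!
# The division formula for `ζ`: `n ζ(nz) − n² ζ(z) = (d/dz) log ψₙ(℘ z, ℘' z/2)`

Topic `Literature/NumberTheory/EllipticCurves`; a proofs-only file (theorems only) in
`namespace PeriodPair`, the logarithmic derivative of the `σ`-formula for the division
polynomials (`PeriodPair.weierstrassSigma_nat_mul`, `WeierstrassSigmaDivision.lean`:
`σ(nz) = (−1)^{n+1} ψₙ(℘ z, ℘' z/2) σ(z)^{n²}`). Since `σ'/σ = ζ`
(tree: `PeriodPair.logDeriv_weierstrassSigma_holds`), differentiating gives, for `z, nz ∉ Λ`,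

* `PeriodPair.weierstrassZeta_nat_mul_sub` —
  `n ζ(nz) − n² ζ(z) = (∂ψₙ/∂z)(z) / ψₙ(℘ z, ℘' z/2)`, where the derivative of
  `z ↦ ψₙ(℘ z, ℘' z/2)` is computed by the chain rule
  (`PeriodPair.hasDerivAt_evalEval_weierstrassP`, valid for every bivariate polynomial `p`):
  `(∂p/∂z) = (∂_X p)(℘, ℘'/2) · ℘' + (∂_Y p)(℘, ℘'/2) · (3℘² − g₂/4)` with
  `∂_Y p = Polynomial.derivative p` and `∂_X p = p.sum (fun i a ↦ C a' Y^i)`, `℘'' = 6℘² − g₂/2`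
  (tree: `PeriodPair.hasDerivAt_derivWeierstrassP`).

In particular `ζ(nz) − n ζ(z)` is a rational function over `ℚ(g₂, g₃)` of `℘(z), ℘'(z)` whose
denominator is `n ψₙ` — the classical division formula for `ζ` (Frobenius–Stickelberger;
Whittaker–Watson §20·53), the `t`-coordinate counterpart of `℘(nz) = φₙ/ψₙ²` needed for the
coordinates of multiples of points of the universal vectorial extension `E♮` (Baker–Wüstholz
2007, §6.8; step S4 of the programme recorded in `WeierstrassPMultiplication.lean`).

## References

* J. H. Silverman, *The Arithmetic of Elliptic Curves*, 2nd ed., GTM 106, Springer 2009,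
  Exercise 6.15, Exercise 3.7. [SilvermanAEC2009]
* E. T. Whittaker, G. N. Watson, *A Course of Modern Analysis*, 4th ed., CUP 1927, §20.53 and
  Examples XX.20–24.
* A. Baker, G. Wüstholz, *Logarithmic Forms and Diophantine Geometry*, CUP 2007, §6.8.
  [BakerWustholz2007]
-/

noncomputable section

open Complex Polynomial
open scoped Polynomial.Bivariate

namespace PeriodPair

variable (L : PeriodPair)

/-- **Chain rule along `z ↦ (℘ z, ℘' z/2)`.** For every bivariate polynomial `p` and `z ∉ Λ`,
`(d/dz) p(℘ z, ℘' z/2) = (∂_X p)(℘ z, ℘' z/2) · ℘'(z) + (∂_Y p)(℘ z, ℘' z/2) · (3℘(z)² − g₂/4)`,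
with `∂_Y = Polynomial.derivative` and `∂_X p = p.sum (fun i a ↦ C a' · Y^i)`; here
`(℘'/2)' = ℘''/2 = 3℘² − g₂/4`. [folklore] -/
theorem hasDerivAt_evalEval_weierstrassP (p : ℂ[X][Y]) {z : ℂ} (hz : z ∉ L.lattice) :
    HasDerivAt (fun w => p.evalEval (℘[L] w) (℘'[L] w / 2))
      ((p.sum fun i a => C (derivative a) * Y ^ i).evalEval (℘[L] z) (℘'[L] z / 2) * ℘'[L] z +
        (derivative p).evalEval (℘[L] z) (℘'[L] z / 2) * (3 * ℘[L] z ^ 2 - L.g₂ / 4)) z := by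
  have h℘ : HasDerivAt ℘[L] (℘'[L] z) z := L.hasDerivAt_weierstrassP hz
  have h℘' : HasDerivAt (fun w => ℘'[L] w / 2) ((6 * ℘[L] z ^ 2 - L.g₂ / 2) / 2) z :=
    (L.hasDerivAt_derivWeierstrassP hz).div_const 2
  refine Polynomial.induction_on' p (fun p q hp hq => ?_) (fun n a => ?_)
  · have hs : ((p + q).sum fun i a => C (derivative a) * Y ^ i) =
        (p.sum fun i a => C (derivative a) * Y ^ i) + (q.sum fun i a => C (derivative a) * Y ^ i) :=
      Polynomial.sum_add_index p q _ (fun i => by simp) (fun i a b => by simp [add_mul])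
    simp only [evalEval_add, hs, derivative_add]
    refine (hp.add hq).congr_deriv ?_
    ring
  · have eF : (fun w => (monomial n a).evalEval (℘[L] w) (℘'[L] w / 2)) =
        fun w => a.eval (℘[L] w) * (℘'[L] w / 2) ^ n := by
      funext w
      rw [Polynomial.evalEval, eval_monomial, eval_mul, eval_pow, eval_C]
    have eS : ((monomial n a).sum fun i a => C (derivative a) * Y ^ i) = C (derivative a) * Y ^ n :=
      Polynomial.sum_monomial_index a _ (by simp)
    have e1 : (C (derivative a) * Y ^ n : ℂ[X][Y]).evalEval (℘[L] z) (℘'[L] z / 2) =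
        (derivative a).eval (℘[L] z) * (℘'[L] z / 2) ^ n := by
      rw [evalEval_mul, evalEval_C, evalEval_pow, evalEval_X]
    have e2 : (monomial (n - 1) (a * n) : ℂ[X][Y]).evalEval (℘[L] z) (℘'[L] z / 2) =
        a.eval (℘[L] z) * n * (℘'[L] z / 2) ^ (n - 1) := by
      rw [Polynomial.evalEval, eval_monomial, eval_mul, eval_pow, eval_C, eval_mul, eval_natCast]
    have h1 : HasDerivAt (fun w => a.eval (℘[L] w)) ((derivative a).eval (℘[L] z) * ℘'[L] z) z :=
      (a.hasDerivAt (℘[L] z)).comp z h℘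
    have h3 := h1.fun_mul (h℘'.fun_pow n)
    rw [eF, eS, derivative_monomial, e1, e2]
    refine h3.congr_deriv ?_
    ring

variable {L}

/-- **The division formula for `ζ`** (logarithmic derivative of Silverman AEC Exercise 6.15):
for `z ∉ Λ`, `n ≥ 1` with `nz ∉ Λ`,
`n ζ(nz) − n² ζ(z) = (d/dz)[ψₙ(℘ z, ℘' z/2)] / ψₙ(℘ z, ℘' z/2)`, the derivative being the explicit
polynomial in `℘(z), ℘'(z)` of `hasDerivAt_evalEval_weierstrassP`. Proof: differentiate
`σ(nz) = (−1)^{n+1} ψₙ(℘ z, ℘' z/2) σ(z)^{n²}` and divide by it, using `σ'/σ = ζ`.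
[cite: SilvermanAEC2009, Exercise 6.15] -/
theorem weierstrassZeta_nat_mul_sub {z : ℂ} (hz : z ∉ L.lattice) {n : ℕ} (hn : n ≠ 0)
    (hnz : (n : ℂ) * z ∉ L.lattice) :
    (n : ℂ) * L.weierstrassZeta (n * z) - (n : ℂ) ^ 2 * L.weierstrassZeta z =
      (((L.curve.ψ n).sum fun i a => C (derivative a) * Y ^ i).evalEval (℘[L] z) (℘'[L] z / 2) *
            ℘'[L] z +
          (derivative (L.curve.ψ n)).evalEval (℘[L] z) (℘'[L] z / 2) *
            (3 * ℘[L] z ^ 2 - L.g₂ / 4)) /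
        (L.curve.ψ n).evalEval (℘[L] z) (℘'[L] z / 2) := by
  -- exponent bookkeeping: `n² = k + 1`
  obtain ⟨k, hk⟩ : ∃ k, n ^ 2 = k + 1 :=
    ⟨n ^ 2 - 1, (Nat.sub_add_cancel (Nat.one_le_pow _ _ (Nat.pos_of_ne_zero hn))).symm⟩
  set c : ℂ := (-1) ^ (n + 1) with hc
  have hσd : Differentiable ℂ L.weierstrassSigma := L.differentiable_weierstrassSigma_holds
  -- the `σ`-formula as an identity of functions
  have hFG : (fun w => L.weierstrassSigma ((n : ℂ) * w)) =
      fun w => c * ((L.curve.ψ n).evalEval (℘[L] w) (℘'[L] w / 2) *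
        L.weierstrassSigma w ^ (k + 1)) := by
    funext w
    rw [L.weierstrassSigma_nat_mul n w, hk, mul_assoc]
  -- derivatives of both sides
  have hmul : HasDerivAt (fun w : ℂ => (n : ℂ) * w) (n : ℂ) z := by
    simpa using (hasDerivAt_id z).const_mul (n : ℂ)
  have hF : HasDerivAt (fun w => L.weierstrassSigma ((n : ℂ) * w))
      (deriv L.weierstrassSigma (n * z) * n) z :=
    (hσd _).hasDerivAt.comp z hmul
  have hψ := L.hasDerivAt_evalEval_weierstrassP (L.curve.ψ n) hz
  have hG := (hψ.fun_mul ((hσd z).hasDerivAt.fun_pow (k + 1))).const_mul c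
  simp only [Nat.add_sub_cancel] at hG
  rw [hFG] at hF
  have E := hF.unique hG
  -- `σ'/σ = ζ` at `z` and at `nz`
  have hs0 : L.weierstrassSigma z ≠ 0 := L.weierstrassSigma_ne_zero hz
  have hψ0 : (L.curve.ψ n).evalEval (℘[L] z) (℘'[L] z / 2) ≠ 0 := fun h0 =>
    hnz (by simpa using (L.evalEval_ψ_eq_zero_iff hz n).mp h0)
  have hc0 : c ≠ 0 := pow_ne_zero _ (neg_ne_zero.mpr one_ne_zero)
  have hζ1 : L.weierstrassZeta z = deriv L.weierstrassSigma z / L.weierstrassSigma z := by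
    rw [← L.logDeriv_weierstrassSigma_holds z hz, logDeriv_apply]
  have hζn : L.weierstrassZeta (n * z) =
      deriv L.weierstrassSigma (n * z) / L.weierstrassSigma (n * z) := by
    rw [← L.logDeriv_weierstrassSigma_holds _ hnz, logDeriv_apply]
  have hSn : L.weierstrassSigma ((n : ℂ) * z) =
      c * ((L.curve.ψ n).evalEval (℘[L] z) (℘'[L] z / 2) * L.weierstrassSigma z ^ (k + 1)) :=
    congrFun hFG z
  have hk' : ((n : ℂ)) ^ 2 = ((k + 1 : ℕ) : ℂ) := by exact_mod_cast hk
  have hA : (n : ℂ) * deriv L.weierstrassSigma (n * z) =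
      c * ((((L.curve.ψ n).sum fun i a => C (derivative a) * Y ^ i).evalEval (℘[L] z) (℘'[L] z / 2) *
              ℘'[L] z +
            (derivative (L.curve.ψ n)).evalEval (℘[L] z) (℘'[L] z / 2) *
              (3 * ℘[L] z ^ 2 - L.g₂ / 4)) *
          L.weierstrassSigma z ^ (k + 1) +
        (L.curve.ψ n).evalEval (℘[L] z) (℘'[L] z / 2) *
          (((k + 1 : ℕ) : ℂ) * L.weierstrassSigma z ^ k * deriv L.weierstrassSigma z)) := by
    rw [mul_comm]
    exact E
  rw [hζn, hζ1, hSn, hk', ← mul_div_assoc, hA]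
  field_simp
  ring

/-- The same in the form **`ζ(nz) − n ζ(z) = (d/dz)[ψₙ(℘ z, ℘' z/2)] / (n ψₙ(℘ z, ℘' z/2))`**.
[cite: SilvermanAEC2009, Exercise 6.15] -/
theorem weierstrassZeta_nat_mul_sub' {z : ℂ} (hz : z ∉ L.lattice) {n : ℕ} (hn : n ≠ 0)
    (hnz : (n : ℂ) * z ∉ L.lattice) :
    L.weierstrassZeta (n * z) - (n : ℂ) * L.weierstrassZeta z =
      (((L.curve.ψ n).sum fun i a => C (derivative a) * Y ^ i).evalEval (℘[L] z) (℘'[L] z / 2) *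
            ℘'[L] z +
          (derivative (L.curve.ψ n)).evalEval (℘[L] z) (℘'[L] z / 2) *
            (3 * ℘[L] z ^ 2 - L.g₂ / 4)) /
        ((n : ℂ) * (L.curve.ψ n).evalEval (℘[L] z) (℘'[L] z / 2)) := by
  have hn' : (n : ℂ) ≠ 0 := by exact_mod_cast hn
  have hψ0 : (L.curve.ψ n).evalEval (℘[L] z) (℘'[L] z / 2) ≠ 0 := fun h0 =>
    hnz (by simpa using (L.evalEval_ψ_eq_zero_iff hz n).mp h0)
  have h := weierstrassZeta_nat_mul_sub hz hn hnz
  rw [eq_div_iff hψ0] at h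
  rw [eq_div_iff (mul_ne_zero hn' hψ0)]
  linear_combination h

end PeriodPair
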